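import Summits.CriticalPhenomena.PercolationContinuityZ3.Theorems.PercNearOneGluingNoHeavyLowerTailThresholdTwoFibre
import Mathlib.Tactic.Linarith

/-!
# `NoHeavyLowerTail` (crux stmt-CriticalPhenomena-4575), lane prim-ineq-gen-4 (gen 19): LEMMA J, the first case of the
# "anti-band Kleitman" family of fibre inequalities (one cube, two up-sets)

Support file (`--supports stmt-CriticalPhenomena-4575`; memo `run/shared/lean/prim/prim-ineq-gen-4/FINDING-FLAG-CERTIFICATES-g19.md` §4b).
Pure finite combinatorics, no definitions, no `sorry`, standard axioms.

CONTEXT.  The lane certifies three-partition positivity `N(Θ_k,V,W) ≥ 0` for a threshold slot fibre by fibre; each fibre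
functional is a "weighted Kleitman" inequality between the traces `W, V` of the two up-sets on a cube `𝒫(Y)` (here: the finsets of a
finite type `α`, `y = card α`), in terms of the common members `W ∩ V` and the cross pairs `W ∩ Vᶜˢ = {z ∈ W : zᶜ ∈ V}` by level.
Gen 19 found (LP certificates + exact oracles) that the inequality missing from the proved list is the ANTI-BAND family
  (AB_l)  `Σ_{i<l ∨ i>y−l} #{u ∈ W∩V : #u = i} ≥ Σ_{i<l ∨ i>y−l} #{z ∈ W ∩ Vᶜˢ : #z = i}`  (`l ≤ y/2`),
verified by exhaustive computation for `y ≤ 7` and conjectured in general ("odd Harris inequality on Hamming balls").  This file proves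
its first non-trivial case `l = 2` for EVERY `y ≥ 3`:

**Lemma J** (`card_cross_outer_one_le`).  For up-sets `W, V` of the finsets of `α`, `3 ≤ card α`:
  `#{z ∈ W∩Vᶜˢ : #z = 1} + #{z ∈ W∩Vᶜˢ : #z = card α − 1} ≤ #{u ∈ W∩V : #u = 1} + #{u ∈ W∩V : #u = card α − 1} + [univ ∈ W ∩ V]`.

PROOF (points, not sets).  With `P = {p : {p} ∈ W}`, `Q = {p : {p}ᶜ ∈ V}`, `P' = {p : {p} ∈ V}`, `Q' = {p : {p}ᶜ ∈ W}` the four families are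
in bijection with `P ∩ Q`, `P' ∩ Q'`, `P ∩ P'`, `Q ∩ Q'`.  Up-closure gives: `p ∈ P, q ≠ p ⟹ q ∈ Q'` and `p ∈ P', q ≠ p ⟹ q ∈ Q` (since `{p} ⊆ {q}ᶜ`),
and any member below `univ` puts `univ` in the family.  If `P = ∅` (resp. `P' = ∅`) one cross family is empty and the other has at most `#(Q∩Q') + 1`
points; otherwise `univ ∈ W ∩ V`, `#(P∩Q) + #(P'∩Q') ≤ #P + #P' = #(P∪P') + #(P∩P')`, and the complement of `Q ∩ Q'` has at most two points,
with two only when `P ∪ P'` has exactly two — so `#(P ∪ P') ≤ #(Q∩Q') + 1` (this is where `3 ≤ card α` enters).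
-/

namespace Summit.CriticalPhenomena.PercolationContinuityZ3.Theorems.AntiBand

open Finset
open scoped FinsetFamily

variable {α : Type*} [DecidableEq α] [Fintype α]

/-- The members of size one of a family of finsets, counted as points. [folklore] -/
theorem card_filter_card_eq_one (F : Finset (Finset α)) :
    #(F.filter fun u => #u = 1) = #(univ.filter fun i : α => ({i} : Finset α) ∈ F) := by
  rw [← card_image_of_injective (univ.filter fun i : α => ({i} : Finset α) ∈ F)
    (singleton_injective : Function.Injective fun i : α => ({i} : Finset α))]
  congr 1
  ext u
  simp only [mem_filter, mem_image, mem_univ, true_and, card_eq_one]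
  constructor
  · rintro ⟨huF, i, rfl⟩
    exact ⟨i, huF, rfl⟩
  · rintro ⟨i, hiF, rfl⟩
    exact ⟨hiF, i, rfl⟩

/-- The members of size `card α − 1` of a family of finsets are the complements of singletons, counted as points
(needs `1 ≤ card α`). [folklore] -/
theorem card_filter_card_eq_pred (F : Finset (Finset α)) (hα : 1 ≤ Fintype.card α) :
    #(F.filter fun u => #u = Fintype.card α - 1) = #(univ.filter fun i : α => ({i} : Finset α)ᶜ ∈ F) := by
  have hinj : Function.Injective fun i : α => ({i} : Finset α)ᶜ :=
    fun i j h => singleton_injective (compl_injective h)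
  rw [← card_image_of_injective (univ.filter fun i : α => ({i} : Finset α)ᶜ ∈ F) hinj]
  congr 1
  ext u
  simp only [mem_filter, mem_image, mem_univ, true_and]
  constructor
  · rintro ⟨huF, hu⟩
    have hc : #(uᶜ) = 1 := by rw [card_compl, hu]; omega
    obtain ⟨i, hi⟩ := card_eq_one.1 hc
    refine ⟨i, ?_, ?_⟩
    · have : ({i} : Finset α)ᶜ = u := by rw [← hi, compl_compl]
      rw [this]; exact huF
    · rw [← hi, compl_compl]
  · rintro ⟨i, hiF, rfl⟩
    refine ⟨hiF, ?_⟩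
    rw [card_compl, card_singleton]

omit [Fintype α] in
/-- In an up-set, a member singleton `{p}` forces every `{q}ᶜ`, `q ≠ p`, to be a member. [folklore] -/
theorem compl_singleton_mem_of_singleton_mem [Fintype α] {W : Finset (Finset α)} (hW : IsUpperSet (W : Set (Finset α)))
    {p q : α} (hp : ({p} : Finset α) ∈ W) (hpq : q ≠ p) : ({q} : Finset α)ᶜ ∈ W := by
  have hsub : ({p} : Finset α) ⊆ ({q} : Finset α)ᶜ := by
    intro x hx
    rw [mem_singleton] at hx
    rw [mem_compl, mem_singleton, hx]
    exact fun h => hpq h.symm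
  exact hW hsub hp

omit [DecidableEq α] in
/-- In an up-set, any member forces `univ` to be a member. [folklore] -/
theorem univ_mem_of_mem {W : Finset (Finset α)} (hW : IsUpperSet (W : Set (Finset α))) {z : Finset α} (hz : z ∈ W) :
    (univ : Finset α) ∈ W :=
  hW (subset_univ z) hz

/-- **Lemma J** (anti-band inequality, case `l = 2`; gen 19).  For up-sets `W, V` of the finsets of a type with `3 ≤ card α`:
cross singletons + cross co-singletons ≤ common singletons + common co-singletons + `[univ ∈ W ∩ V]`. [this work] -/
theorem card_cross_outer_one_le (W V : Finset (Finset α)) (hW : IsUpperSet (W : Set (Finset α)))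
    (hV : IsUpperSet (V : Set (Finset α))) (hα : 3 ≤ Fintype.card α) :
    #((W ∩ Vᶜˢ).filter fun z => #z = 1) + #((W ∩ Vᶜˢ).filter fun z => #z = Fintype.card α - 1)
      ≤ #((W ∩ V).filter fun u => #u = 1) + #((W ∩ V).filter fun u => #u = Fintype.card α - 1)
        + (if (univ : Finset α) ∈ W ∩ V then 1 else 0) := by
  have hα1 : 1 ≤ Fintype.card α := by omega
  rw [card_filter_card_eq_one, card_filter_card_eq_pred _ hα1, card_filter_card_eq_one, card_filter_card_eq_pred _ hα1]
  -- the four point sets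
  set P : Finset α := univ.filter fun i : α => ({i} : Finset α) ∈ W with hP
  set Q : Finset α := univ.filter fun i : α => ({i} : Finset α)ᶜ ∈ V with hQ
  set P' : Finset α := univ.filter fun i : α => ({i} : Finset α) ∈ V with hP'
  set Q' : Finset α := univ.filter fun i : α => ({i} : Finset α)ᶜ ∈ W with hQ'
  have hC1 : (univ.filter fun i : α => ({i} : Finset α) ∈ W ∩ Vᶜˢ) = P ∩ Q := by
    ext i; simp only [P, Q, mem_filter, mem_univ, true_and, mem_inter, mem_compls]
  have hC2 : (univ.filter fun i : α => ({i} : Finset α)ᶜ ∈ W ∩ Vᶜˢ) = Q' ∩ P' := by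
    ext i; simp only [P', Q', mem_filter, mem_univ, true_and, mem_inter, mem_compls, compl_compl]
  have hA1 : (univ.filter fun i : α => ({i} : Finset α) ∈ W ∩ V) = P ∩ P' := by
    ext i; simp only [P, P', mem_filter, mem_univ, true_and, mem_inter]
  have hA2 : (univ.filter fun i : α => ({i} : Finset α)ᶜ ∈ W ∩ V) = Q' ∩ Q := by
    ext i; simp only [Q, Q', mem_filter, mem_univ, true_and, mem_inter]
  rw [hC1, hC2, hA1, hA2]
  -- structural facts
  have hPQ' : ∀ p ∈ P, ∀ q, q ≠ p → q ∈ Q' := by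
    intro p hp q hqp
    simp only [P, Q', mem_filter, mem_univ, true_and] at hp ⊢
    exact compl_singleton_mem_of_singleton_mem hW hp hqp
  have hP'Q : ∀ p ∈ P', ∀ q, q ≠ p → q ∈ Q := by
    intro p hp q hqp
    simp only [P', Q, mem_filter, mem_univ, true_and] at hp ⊢
    exact compl_singleton_mem_of_singleton_mem hV hp hqp
  have hy : #(univ : Finset α) = Fintype.card α := card_univ
  -- Case P = ∅ : the first cross family is empty
  by_cases hPe : P = ∅
  · have h1 : #(P ∩ Q) = 0 := by rw [hPe, empty_inter, card_empty]
    rw [h1, zero_add]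
    by_cases hC2e : Q' ∩ P' = ∅
    · rw [hC2e, card_empty]; exact Nat.zero_le _
    · obtain ⟨p1, hp1⟩ := nonempty_iff_ne_empty.2 hC2e
      rw [mem_inter] at hp1
      have huniv : (univ : Finset α) ∈ W ∩ V := by
        have h1' : ({p1} : Finset α)ᶜ ∈ W := by
          have := hp1.1; simp only [Q', mem_filter, mem_univ, true_and] at this; exact this
        have h2' : ({p1} : Finset α) ∈ V := by
          have := hp1.2; simp only [P', mem_filter, mem_univ, true_and] at this; exact this
        rw [mem_inter]; exact ⟨univ_mem_of_mem hW h1', univ_mem_of_mem hV h2'⟩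
      rw [if_pos huniv]
      -- Q ⊇ univ \ {p1}, hence Q' ∩ P' ⊆ (Q' ∩ Q) ∪ {p1}
      have hsub : Q' ∩ P' ⊆ insert p1 (Q' ∩ Q) := by
        intro q hq
        rw [mem_inter] at hq
        rw [mem_insert, mem_inter]
        by_cases hq1 : q = p1
        · exact Or.inl hq1
        · exact Or.inr ⟨hq.1, hP'Q p1 hp1.2 q hq1⟩
      have := (card_le_card hsub).trans (card_insert_le p1 (Q' ∩ Q))
      omega
  by_cases hP'e : P' = ∅
  · have h2 : #(Q' ∩ P') = 0 := by rw [hP'e, inter_empty, card_empty]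
    rw [h2, add_zero]
    by_cases hC1e : P ∩ Q = ∅
    · rw [hC1e, card_empty]; exact Nat.zero_le _
    · obtain ⟨p1, hp1⟩ := nonempty_iff_ne_empty.2 hC1e
      rw [mem_inter] at hp1
      have huniv : (univ : Finset α) ∈ W ∩ V := by
        have h1' : ({p1} : Finset α) ∈ W := by
          have := hp1.1; simp only [P, mem_filter, mem_univ, true_and] at this; exact this
        have h2' : ({p1} : Finset α)ᶜ ∈ V := by
          have := hp1.2; simp only [Q, mem_filter, mem_univ, true_and] at this; exact this
        rw [mem_inter]; exact ⟨univ_mem_of_mem hW h1', univ_mem_of_mem hV h2'⟩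
      rw [if_pos huniv]
      have hsub : P ∩ Q ⊆ insert p1 (Q' ∩ Q) := by
        intro q hq
        rw [mem_inter] at hq
        rw [mem_insert, mem_inter]
        by_cases hq1 : q = p1
        · exact Or.inl hq1
        · exact Or.inr ⟨hPQ' p1 hp1.1 q hq1, hq.2⟩
      have := (card_le_card hsub).trans (card_insert_le p1 (Q' ∩ Q))
      omega
  -- Main case: P, P' nonempty; then univ ∈ W ∩ V
  obtain ⟨p0, hp0⟩ := nonempty_iff_ne_empty.2 hPe
  obtain ⟨p0', hp0'⟩ := nonempty_iff_ne_empty.2 hP'e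
  have huniv : (univ : Finset α) ∈ W ∩ V := by
    have hp0W : ({p0} : Finset α) ∈ W := by
      have := hp0; simp only [P, mem_filter, mem_univ, true_and] at this; exact this
    have hp0'V : ({p0'} : Finset α) ∈ V := by
      have := hp0'; simp only [P', mem_filter, mem_univ, true_and] at this; exact this
    rw [mem_inter]
    exact ⟨univ_mem_of_mem hW hp0W, univ_mem_of_mem hV hp0'V⟩
  rw [if_pos huniv]
  -- #(P∩Q) + #(Q'∩P') ≤ #P + #P' = #(P ∪ P') + #(P ∩ P')
  have hle1 : #(P ∩ Q) ≤ #P := card_le_card inter_subset_left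
  have hle2 : #(Q' ∩ P') ≤ #P' := card_le_card inter_subset_right
  have hPP' : #(P ∪ P') + #(P ∩ P') = #P + #P' := card_union_add_card_inter P P'
  -- the complement of Q ∩ Q' is small: every q ∉ Q' equals p0... precisely: q ∉ Q' → P ⊆ {q}; q ∉ Q → P' ⊆ {q}
  have hQ'c : ∀ q, q ∉ Q' → P = {q} := by
    intro q hq
    apply eq_singleton_iff_unique_mem.2
    constructor
    · by_contra hqP
      exact hq (hPQ' p0 hp0 q (fun h => hqP (h ▸ hp0)))
    · intro x hx
      by_contra hxq
      exact hq (hPQ' x hx q (fun h => hxq h.symm))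
  have hQc : ∀ q, q ∉ Q → P' = {q} := by
    intro q hq
    apply eq_singleton_iff_unique_mem.2
    constructor
    · by_contra hqP
      exact hq (hP'Q p0' hp0' q (fun h => hqP (h ▸ hp0')))
    · intro x hx
      by_contra hxq
      exact hq (hP'Q x hx q (fun h => hxq h.symm))
  -- Goal: #(P ∪ P') ≤ #(Q' ∩ Q) + 1.  The complement of Q' ∩ Q lies in a set of ≤ 2 points; if it has 2 points then P ∪ P' has 2 points.
  have key : #(P ∪ P') ≤ #(Q' ∩ Q) + 1 := by
    by_cases hall : ∀ q, q ∈ Q' ∩ Q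
    · have hQQ : Q' ∩ Q = univ := eq_univ_iff_forall.2 hall
      rw [hQQ, hy]
      have : #(P ∪ P') ≤ Fintype.card α := by rw [← hy]; exact card_le_card (subset_univ _)
      omega
    · push Not at hall
      obtain ⟨q1, hq1⟩ := hall
      -- q1 ∉ Q' ∩ Q: then P = {q1} or P' = {q1}
      by_cases hall2 : ∀ q, q ≠ q1 → q ∈ Q' ∩ Q
      · -- complement is exactly {q1}: #(Q'∩Q) = y - 1, and #(P ∪ P') ≤ y
        have hsub : (univ : Finset α).erase q1 ⊆ Q' ∩ Q := by
          intro q hq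
          rw [mem_erase] at hq
          exact hall2 q hq.1
        have h1 : #((univ : Finset α).erase q1) = Fintype.card α - 1 := by
          rw [card_erase_of_mem (mem_univ q1), hy]
        have h2 := card_le_card hsub
        have h3 : #(P ∪ P') ≤ Fintype.card α := by rw [← hy]; exact card_le_card (subset_univ _)
        omega
      · push Not at hall2
        obtain ⟨q2, hq21, hq2⟩ := hall2
        -- two distinct points outside Q' ∩ Q: each forces P or P' to be a singleton; they must force different ones
        have hPP'sub : P ∪ P' ⊆ {q1, q2} := by
          -- from q1: P = {q1} or P' = {q1}; from q2: P = {q2} or P' = {q2}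
          rw [mem_inter, not_and_or] at hq1 hq2
          intro x hx
          rw [mem_union] at hx
          rw [mem_insert, mem_singleton]
          rcases hq1 with h1 | h1 <;> rcases hq2 with h2 | h2
          · -- P = {q1} and P = {q2}: impossible as q2 ≠ q1 — then both force P
            have e1 := hQ'c q1 h1; have e2 := hQ'c q2 h2
            exact absurd (by rw [e1] at e2; exact (singleton_injective e2).symm) hq21
          · have e1 := hQ'c q1 h1; have e2 := hQc q2 h2
            rcases hx with hx | hx
            · left; rw [e1] at hx; exact mem_singleton.1 hx
            · right; rw [e2] at hx; exact mem_singleton.1 hx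
          · have e1 := hQc q1 h1; have e2 := hQ'c q2 h2
            rcases hx with hx | hx
            · right; rw [e2] at hx; exact mem_singleton.1 hx
            · left; rw [e1] at hx; exact mem_singleton.1 hx
          · have e1 := hQc q1 h1; have e2 := hQc q2 h2
            exact absurd (by rw [e1] at e2; exact (singleton_injective e2).symm) hq21
        have hPP'2 : #(P ∪ P') ≤ 2 := (card_le_card hPP'sub).trans (card_insert_le q1 {q2} |>.trans (by rw [card_singleton]))
        -- and #(Q' ∩ Q) ≥ y - 2 ≥ 1
        have hsub : ((univ : Finset α).erase q1).erase q2 ⊆ Q' ∩ Q := by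
          intro q hq
          rw [mem_erase, mem_erase] at hq
          by_contra hqn
          -- q ∉ Q'∩Q forces P = {q} or P' = {q}, contradicting the values at q1, q2
          rw [mem_inter, not_and_or] at hqn hq1 hq2
          rcases hqn with h | h
          · have e := hQ'c q h
            rcases hq1 with h1 | h1
            · have e1 := hQ'c q1 h1; rw [e] at e1; exact hq.2.1 (singleton_injective e1)
            · rcases hq2 with h2 | h2
              · have e2 := hQ'c q2 h2; rw [e] at e2; exact hq.1 (singleton_injective e2)
              · have e1 := hQc q1 h1; have e2 := hQc q2 h2; rw [e1] at e2; exact hq21 (singleton_injective e2).symm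
          · have e := hQc q h
            rcases hq1 with h1 | h1
            · rcases hq2 with h2 | h2
              · have e1 := hQ'c q1 h1; have e2 := hQ'c q2 h2; rw [e1] at e2; exact hq21 (singleton_injective e2).symm
              · have e2 := hQc q2 h2; rw [e] at e2; exact hq.1 (singleton_injective e2)
            · have e1 := hQc q1 h1; rw [e] at e1; exact hq.2.1 (singleton_injective e1)
        have hq2m : q2 ∈ (univ : Finset α).erase q1 := by rw [mem_erase]; exact ⟨hq21, mem_univ q2⟩
        have h1 : #(((univ : Finset α).erase q1).erase q2) = Fintype.card α - 2 := by
          rw [card_erase_of_mem hq2m, card_erase_of_mem (mem_univ q1), hy]; omega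
        have h2 := card_le_card hsub
        omega
  omega

end Summit.CriticalPhenomena.PercolationContinuityZ3.Theorems.AntiBand
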